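import Summits.HodgeConjecture.CorCM.GaloisCyclicFourCompositumReal
import Summits.HodgeConjecture.CorCM.AbelianTwoGroupInvolutionLemmas
import HarnessLib

/-!
# (Totally real Galois field of even degree `≥ 6` with ELEMENTARY ABELIAN group) · (cyclic quartic CM field) is BAD —
# the coset-adapted level function; hence every totally real Galois `M` of even degree `≥ 6` dies under `ℚ(ζ₅)`-type
# factors

COR-CM (cell `pub-hodgecm2`), binder seat b04 (gen 23), count-neutral claim CYCLIC-BY-MULTIPLIERS, part XI (blanket
NAME ACK `CorCM/GaloisCyclicFour*`, HOME/INBOX l.9773).  HC_CM is NOT proved here; unconditional negative-side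
examples.  Companion of part X (`GaloisCyclicFourCompositumReal`): there the level function `ℓ(1) = 0`,
`ℓ(h₁) = 2`, rest split evenly between `1` and `3`, is primitive because `h₁² ≠ 1`; when `Gal(M/ℚ) = H` has
exponent `2` no such `h₁` exists, and the period `(h₁, 2)` is killed instead by putting a whole coset `{x, h₁x}`
into the level set `ℓ⁻¹(1)` (`ℓ(h₁x)` would have to be `ℓ(x) + 2 = 3`).

* `exists_simple_degenerate_of_real_cyclicFour_levels'` — the abstract level-function criterion of part X with the
  hypothesis `h₁² ≠ 1` replaced by a coset witness `ℓ(x) = ℓ(h₁x) = 1`;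
* `exists_simple_degenerate_of_real_cyclicFour_compositum_expTwo` — `Gal(K/ℚ) ≅ H × C₄`, `c = (1,2)`, `H` of
  exponent `2` and order `≥ 6` (so `≥ 8`) ⟹ a SIMPLE DEGENERATE abelian variety of dimension `2|H|` with CM by `K`;
* `exists_simple_degenerate_of_real_cyclicFour_compositum'` — THE UNION: **`Gal(K/ℚ) ≅ H × C₄` with `c = (1, 2)` and
  `|H| ≥ 6` even ⟹ BAD**, i.e. every compositum of a totally real Galois field of even degree `≥ 6` with a linearly
  disjoint cyclic quartic CM field carries a simple CM abelian variety with exceptional Hodge classes on a power.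
  (Degree `4`: `C₄ × C₄` is bad by the level function `(0,2,1,3)` but `C₂² × C₄` is GOOD, gen 15; odd degree has no
  balanced level function.)

References: Shimura (1998), §6.2 Thm. 3, §8.2 Prop. 26 [cite: Shimura1998]; Gordon (1999), Thm. 6.4, §9
[cite: Gordon1999HodgeAVSurvey].
-/

noncomputable section

open CategoryTheory CategoryTheory.Limits NumberField
open scoped BigOperators

namespace Summit.HodgeConjecture.CorCM.GaloisModels

open Literature.NumberTheory.ComplexMultiplication
open Literature.AlgebraicGeometry.Motives (AbelianVariety CMType)
open Literature.AlgebraicGeometry.HodgeTheory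
open Literature.AlgebraicGeometry.ComplexMultiplication (IsCMTypeRealisation)
open Literature.AlgebraicGeometry.Pohlmann1968
open Literature.Barriers.HodgeConjecture (divisorClassesSpan)

section Levels

variable {H : Type*} [Group H] [Fintype H] [DecidableEq H]
variable {K : Type} [Field K] [NumberField K] [IsCMField K] [IsGalois ℚ K]

/-- **Level functions give simple degenerate CM types (coset-witness form).**  `Gal(K/ℚ) ≅ H × C₄`, `c = (1, 2)`;
a level function `ℓ : H → ℤ/4` with `ℓ⁻¹(0) = {1}`, `ℓ⁻¹(2) = {h₁}`, `ℓ(x) = ℓ(h₁x) = 1` for some `x`,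
`#ℓ⁻¹(1) ≥ 2` and every `w` in exactly `|H|/2` of the intervals `{ℓ(q), ℓ(q)+1}` yields a SIMPLE DEGENERATE abelian
variety of dimension `2|H|` with CM by `K`.
[cite: Shimura1998, §6.2 Thm. 3 and §8.2 Prop. 26] [cite: Gordon1999HodgeAVSurvey, Thm. 6.4 and §9.3] -/
theorem exists_simple_degenerate_of_real_cyclicFour_levels' (e : (K ≃ₐ[ℚ] K) ≃* H × Multiplicative (ZMod 4))
    (hc : e ((IsCMField.complexConj K).restrictScalars ℚ) = (1, Multiplicative.ofAdd 2)) (ℓ : H → ZMod 4)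
    (h₁ x : H) (hx : ℓ x = 1) (hx' : ℓ (h₁ * x) = 1) (h0 : ∀ q, ℓ q = 0 ↔ q = 1) (h2 : ∀ q, ℓ q = 2 ↔ q = h₁)
    (hbig : 2 ≤ (Finset.univ.filter fun q => ℓ q = 1).card)
    (hfib : ∀ w : ZMod 4, 2 * (Finset.univ.filter fun q => ℓ q = w ∨ ℓ q = w + 3).card = Fintype.card H) :
    ∃ (Φ : CMType K) (φ₀ : K →+* ℂ) (A : AbelianVariety ℂ) (ι : 𝓞 K →+* End A)
      (θ : K →+* Module.End ℂ (complexBetti A.X 1)),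
      IsPrimitive (ℂ ≃+* ℂ) Φ.1 φ₀ ∧ ¬ IsNondegenerate Φ ∧ IsCMTypeRealisation Φ A ι θ ∧ A.IsSimple ∧
      A.dim = 2 * Fintype.card H ∧
      ∃ n p : ℕ, ∃ x : complexBetti (⨁ fun _ : Fin n => A).X (2 * p), IsRationalClass x ∧
        IsOfHodgeType (⨁ fun _ : Fin n => A).dim (⨁ fun _ : Fin n => A).X (2 * p) p p x ∧
        x ∉ divisorClassesSpan (⨁ fun _ : Fin n => A).X (⨁ fun _ : Fin n => A).dim p := by
  classical
  have hmem : ∀ (q : H) (v : Multiplicative (ZMod 4)),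
      v ∈ (Finset.univ.filter fun v : Multiplicative (ZMod 4) =>
        Multiplicative.toAdd v = ℓ q ∨ Multiplicative.toAdd v = ℓ q + 1) ↔
      (Multiplicative.toAdd v = ℓ q ∨ Multiplicative.toAdd v = ℓ q + 1) := fun q v => by
    simp only [Finset.mem_filter, Finset.mem_univ, true_and]
  have hmain := exists_simple_degenerate_of_model_fibres e 1 (Multiplicative.ofAdd (2 : ZMod 4)) hc (by decide)
    (fun q => Finset.univ.filter fun v : Multiplicative (ZMod 4) =>
      Multiplicative.toAdd v = ℓ q ∨ Multiplicative.toAdd v = ℓ q + 1)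
    (fun q v => by
      rw [hmem, hmem, one_mul, toAdd_mul, toAdd_ofAdd]
      exact zmod_four_interval_cm (ℓ q) (Multiplicative.toAdd v))
    (by
      rintro ⟨a, b⟩ hy
      by_contra hcon
      push Not at hcon
      have key : ∀ q, Multiplicative.toAdd b + ℓ q = ℓ (a * q) := by
        intro q
        have m1 := (hcon q (Multiplicative.ofAdd (ℓ q))).1
          (by rw [hmem, toAdd_ofAdd]; exact Or.inl rfl)
        have m2 := (hcon q (Multiplicative.ofAdd (ℓ q + 1))).1
          (by rw [hmem, toAdd_ofAdd]; exact Or.inr rfl)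
        rw [hmem, toAdd_mul, toAdd_ofAdd] at m1 m2
        rw [← add_assoc] at m2
        exact zmod_four_interval_start _ _ m1 m2
      have key1 : ℓ a = Multiplicative.toAdd b := by
        rw [← mul_one a, ← key 1, (h0 1).2 rfl, add_zero]
      rcases TwoGroupPieces.zmod_four_cases (Multiplicative.toAdd b) with hb | hb | hb | hb
      · -- `b = 0`: `ℓ a = 0`, so `a = 1`
        rw [hb, h0] at key1
        apply hy
        rw [key1, show b = 1 from by rw [← ofAdd_toAdd b, hb]; rfl]
        rfl
      · -- `b = 1`: the level set `ℓ⁻¹(1)` is mapped by `a⁻¹` into `ℓ⁻¹(0) = {1}`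
        have hS : (Finset.univ.filter fun q => ℓ q = 1) ⊆ {a} := by
          intro q hq
          rw [Finset.mem_filter] at hq
          have hk := key (a⁻¹ * q)
          rw [mul_inv_cancel_left, hq.2, hb] at hk
          have h' : ℓ (a⁻¹ * q) = 0 := by linear_combination hk
          rw [h0] at h'
          rw [Finset.mem_singleton, ← mul_inv_cancel_left a q, h', mul_one]
        have := Finset.card_le_card hS
        rw [Finset.card_singleton] at this
        omega
      · -- `b = 2`: `a = h₁`, then `ℓ (h₁ x) = ℓ x + 2 = 3`, not `1`
        rw [hb, h2] at key1
        have hk := key x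
        rw [key1, hb, hx, hx'] at hk
        exact absurd hk (by decide)
      · -- `b = 3`: the level set `ℓ⁻¹(1)` is mapped by `a` into `ℓ⁻¹(0) = {1}`
        have hS : (Finset.univ.filter fun q => ℓ q = 1) ⊆ {a⁻¹} := by
          intro q hq
          rw [Finset.mem_filter] at hq
          have hk := key q
          rw [hq.2, hb, show (3 : ZMod 4) + 1 = 0 from by decide] at hk
          have h' := (h0 _).1 hk.symm
          rw [Finset.mem_singleton, ← inv_mul_cancel_left a q, h', mul_one]
        have := Finset.card_le_card hS
        rw [Finset.card_singleton] at this
        omega)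
    (fun v => by
      rw [← hfib (Multiplicative.toAdd v)]
      congr 2
      ext q
      simp only [Finset.mem_filter, Finset.mem_univ, true_and]
      exact zmod_four_interval_mem (ℓ q) (Multiplicative.toAdd v))
  rwa [Fintype.card_multiplicative, ZMod.card,
    show Fintype.card H * 4 / 2 = 2 * Fintype.card H by omega] at hmain

/-- **(Totally real Galois `M` of even degree `≥ 6` with ELEMENTARY ABELIAN group) · (cyclic quartic CM field) is
BAD**: `Gal(K/ℚ) ≅ H × C₄`, `c = (1, 2)`, `|H| ≥ 6` even, `h² = 1` for all `h ∈ H` ⟹ a SIMPLE DEGENERATE abelian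
variety of dimension `2|H|` with CM by `K` (level function `ℓ(1) = 0`, `ℓ(h₁) = 2`, a coset `{x, h₁x}` and half of
the rest at level `1`, the remainder at level `3`). [cite: Shimura1998, §6.2 Thm. 3 and §8.2 Prop. 26]
[cite: Gordon1999HodgeAVSurvey, Thm. 6.4 and §9.3] -/
theorem exists_simple_degenerate_of_real_cyclicFour_compositum_expTwo
    (e : (K ≃ₐ[ℚ] K) ≃* H × Multiplicative (ZMod 4))
    (hc : e ((IsCMField.complexConj K).restrictScalars ℚ) = (1, Multiplicative.ofAdd 2))
    (heven : Even (Fintype.card H)) (h6 : 6 ≤ Fintype.card H) (hexp : ∀ h : H, h * h = 1) :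
    ∃ (Φ : CMType K) (φ₀ : K →+* ℂ) (A : AbelianVariety ℂ) (ι : 𝓞 K →+* End A)
      (θ : K →+* Module.End ℂ (complexBetti A.X 1)),
      IsPrimitive (ℂ ≃+* ℂ) Φ.1 φ₀ ∧ ¬ IsNondegenerate Φ ∧ IsCMTypeRealisation Φ A ι θ ∧ A.IsSimple ∧
      A.dim = 2 * Fintype.card H ∧
      ∃ n p : ℕ, ∃ x : complexBetti (⨁ fun _ : Fin n => A).X (2 * p), IsRationalClass x ∧
        IsOfHodgeType (⨁ fun _ : Fin n => A).dim (⨁ fun _ : Fin n => A).X (2 * p) p p x ∧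
        x ∉ divisorClassesSpan (⨁ fun _ : Fin n => A).X (⨁ fun _ : Fin n => A).dim p := by
  classical
  obtain ⟨m, hm⟩ := heven
  -- an element `h₁ ≠ 1`, an element `x ∉ {1, h₁}`; then `h₁ x ∉ {1, h₁, x}`
  obtain ⟨h₁, h1ne⟩ : ∃ h₁ : H, h₁ ≠ 1 := by
    by_contra hno
    push Not at hno
    have : Fintype.card H ≤ 1 := Fintype.card_le_one_iff.2 fun a b => by rw [hno a, hno b]
    omega
  have hinv : ∀ h : H, h⁻¹ = h := fun h => inv_eq_of_mul_eq_one_right (hexp h)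
  obtain ⟨x, hx⟩ : ∃ x : H, x ∉ ({1, h₁} : Finset H) := by
    by_contra hno
    push Not at hno
    have : (Finset.univ : Finset H) ⊆ {1, h₁} := fun q _ => hno q
    have := (Finset.card_le_card this).trans (Finset.card_le_two)
    rw [Finset.card_univ] at this
    omega
  rw [Finset.mem_insert, Finset.mem_singleton, not_or] at hx
  have hx1 : h₁ * x ≠ 1 := fun h => hx.2 (((inv_eq_of_mul_eq_one_right h).symm).trans (hinv h₁))
  have hx2 : h₁ * x ≠ h₁ := fun h => hx.1 (mul_left_cancel (h.trans (mul_one h₁).symm))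
  have hx3 : h₁ * x ≠ x := fun h => h1ne (mul_right_cancel (h.trans (one_mul x).symm))
  have hn1' : (1 : H) ∉ ({h₁, x, h₁ * x} : Finset H) := by
    rw [Finset.mem_insert, Finset.mem_insert, Finset.mem_singleton, not_or, not_or]
    exact ⟨h1ne.symm, fun h => hx.1 h.symm, fun h => hx1 h.symm⟩
  have hnh' : h₁ ∉ ({x, h₁ * x} : Finset H) := by
    rw [Finset.mem_insert, Finset.mem_singleton, not_or]
    exact ⟨fun h => hx.2 h.symm, fun h => hx2 h.symm⟩
  have hR : (Finset.univ \ {1, h₁, x, h₁ * x} : Finset H).card = Fintype.card H - 4 := by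
    rw [Finset.card_sdiff_of_subset (Finset.subset_univ _), Finset.card_univ,
      Finset.card_insert_of_notMem hn1', Finset.card_insert_of_notMem hnh', Finset.card_pair hx3.symm]
  obtain ⟨S', hS'sub, hS'card⟩ := Finset.exists_subset_card_eq
    (s := (Finset.univ \ {1, h₁, x, h₁ * x} : Finset H)) (n := m - 3) (by omega)
  set S : Finset H := insert x (insert (h₁ * x) S') with hS_def
  have hxS' : x ∉ S' := fun h => by simpa using hS'sub h
  have hyS' : h₁ * x ∉ S' := fun h => by simpa using hS'sub h
  have hScard : S.card = m - 1 := by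
    rw [hS_def, Finset.card_insert_of_notMem, Finset.card_insert_of_notMem hyS']
    · omega
    · rw [Finset.mem_insert, not_or]; exact ⟨hx3.symm, hxS'⟩
  have h1S : (1 : H) ∉ S := by
    rw [hS_def, Finset.mem_insert, Finset.mem_insert, not_or, not_or]
    exact ⟨Ne.symm hx.1, Ne.symm hx1, fun h => by simpa using hS'sub h⟩
  have hhS : h₁ ∉ S := by
    rw [hS_def, Finset.mem_insert, Finset.mem_insert, not_or, not_or]
    exact ⟨fun h => hx.2 h.symm, fun h => hx2 h.symm, fun h => by simpa using hS'sub h⟩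
  have hxS : x ∈ S := by rw [hS_def]; exact Finset.mem_insert_self _ _
  have hyS : h₁ * x ∈ S := by rw [hS_def]; exact Finset.mem_insert_of_mem (Finset.mem_insert_self _ _)
  let ℓ : H → ZMod 4 := fun q => if q = 1 then 0 else if q = h₁ then 2 else if q ∈ S then 1 else 3
  -- the value of `ℓ` in the four regions
  have hval : ∀ q, (q = 1 ∧ ℓ q = 0) ∨ (q = h₁ ∧ ℓ q = 2) ∨ (q ∈ S ∧ ℓ q = 1) ∨
      (q ≠ 1 ∧ q ≠ h₁ ∧ q ∉ S ∧ ℓ q = 3) := fun q => by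
    by_cases hq1 : q = 1
    · exact Or.inl ⟨hq1, by simp [ℓ, hq1]⟩
    by_cases hq2 : q = h₁
    · exact Or.inr (Or.inl ⟨hq2, by simp [ℓ, hq2, h1ne]⟩)
    by_cases hq3 : q ∈ S
    · exact Or.inr (Or.inr (Or.inl ⟨hq3, by simp [ℓ, hq1, hq2, hq3]⟩))
    · exact Or.inr (Or.inr (Or.inr ⟨hq1, hq2, hq3, by simp [ℓ, hq1, hq2, hq3]⟩))
  have hn1 : ¬ ((1 : H) = h₁ ∨ (1 : H) ∈ S) := fun h => h.elim (Ne.symm h1ne) h1S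
  have hnh : ¬ (h₁ = 1 ∨ h₁ ∈ S) := fun h => h.elim h1ne hhS
  -- level sets
  have hL1 : (Finset.univ.filter fun q => ℓ q = 1) = S := by
    ext q
    simp only [Finset.mem_filter, Finset.mem_univ, true_and]
    rcases hval q with ⟨h, hl⟩ | ⟨h, hl⟩ | ⟨h, hl⟩ | ⟨-, -, h'', hl⟩ <;> rw [hl]
    · rw [h]; exact ⟨fun h' => absurd h' (by decide), fun h' => absurd h' h1S⟩
    · rw [h]; exact ⟨fun h' => absurd h' (by decide), fun h' => absurd h' hhS⟩
    · exact ⟨fun _ => h, fun _ => rfl⟩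
    · exact ⟨fun h' => absurd h' (by decide), fun h' => absurd h' h''⟩
  have hA : (Finset.univ.filter fun q => ℓ q = 1 ∨ ℓ q = 0) = insert 1 S := by
    ext q
    simp only [Finset.mem_filter, Finset.mem_univ, true_and, Finset.mem_insert]
    rcases hval q with ⟨h, hl⟩ | ⟨h, hl⟩ | ⟨h, hl⟩ | ⟨h, -, h'', hl⟩ <;> rw [hl]
    · rw [h]; exact ⟨fun _ => Or.inl rfl, fun _ => by decide⟩
    · rw [h]; exact ⟨fun h' => absurd h' (by decide), fun h' => absurd h' hnh⟩
    · exact ⟨fun _ => Or.inr h, fun _ => by decide⟩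
    · exact ⟨fun h' => absurd h' (by decide), fun h' => absurd h' (fun h₀ => h₀.elim h h'')⟩
  have hB : (Finset.univ.filter fun q => ℓ q = 2 ∨ ℓ q = 1) = insert h₁ S := by
    ext q
    simp only [Finset.mem_filter, Finset.mem_univ, true_and, Finset.mem_insert]
    rcases hval q with ⟨h, hl⟩ | ⟨h, hl⟩ | ⟨h, hl⟩ | ⟨-, h', h'', hl⟩ <;> rw [hl]
    · rw [h]; exact ⟨fun h' => absurd h' (by decide), fun h' => absurd h' hn1⟩
    · rw [h]; exact ⟨fun _ => Or.inl rfl, fun _ => by decide⟩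
    · exact ⟨fun _ => Or.inr h, fun _ => by decide⟩
    · exact ⟨fun h₀ => absurd h₀ (by decide), fun h₀ => absurd h₀ (fun h₀ => h₀.elim h' h'')⟩
  have hC : (Finset.univ.filter fun q => ℓ q = 0 ∨ ℓ q = 3) = Finset.univ \ insert h₁ S := by
    ext q
    simp only [Finset.mem_filter, Finset.mem_univ, true_and, Finset.mem_sdiff, Finset.mem_insert]
    rcases hval q with ⟨h, hl⟩ | ⟨h, hl⟩ | ⟨h, hl⟩ | ⟨-, h', h'', hl⟩ <;> rw [hl]
    · rw [h]; exact ⟨fun _ => hn1, fun _ => by decide⟩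
    · rw [h]; exact ⟨fun h' => absurd h' (by decide), fun h' => absurd (Or.inl rfl) h'⟩
    · exact ⟨fun h' => absurd h' (by decide), fun h' => absurd (Or.inr h) h'⟩
    · exact ⟨fun _ => fun h₀ => h₀.elim h' h'', fun _ => by decide⟩
  have hD : (Finset.univ.filter fun q => ℓ q = 3 ∨ ℓ q = 2) = Finset.univ \ insert 1 S := by
    ext q
    simp only [Finset.mem_filter, Finset.mem_univ, true_and, Finset.mem_sdiff, Finset.mem_insert]
    rcases hval q with ⟨h, hl⟩ | ⟨h, hl⟩ | ⟨h, hl⟩ | ⟨h, -, h'', hl⟩ <;> rw [hl]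
    · rw [h]; exact ⟨fun h' => absurd h' (by decide), fun h' => absurd (Or.inl rfl) h'⟩
    · rw [h]; exact ⟨fun _ => hnh, fun _ => by decide⟩
    · exact ⟨fun h' => absurd h' (by decide), fun h' => absurd (Or.inr h) h'⟩
    · exact ⟨fun _ => fun h₀ => h₀.elim h h'', fun _ => by decide⟩
  have hcard1 : (insert (1 : H) S).card = m := by rw [Finset.card_insert_of_notMem h1S]; omega
  have hcardh : (insert h₁ S).card = m := by rw [Finset.card_insert_of_notMem hhS]; omega
  have hℓx : ℓ x = 1 := by
    rcases hval x with ⟨h, -⟩ | ⟨h, -⟩ | ⟨-, hl⟩ | ⟨-, -, h, -⟩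
    exacts [absurd h hx.1, absurd h hx.2, hl, absurd hxS h]
  have hℓy : ℓ (h₁ * x) = 1 := by
    rcases hval (h₁ * x) with ⟨h, -⟩ | ⟨h, -⟩ | ⟨-, hl⟩ | ⟨-, -, h, -⟩
    exacts [absurd h hx1, absurd h hx2, hl, absurd hyS h]
  refine exists_simple_degenerate_of_real_cyclicFour_levels' e hc ℓ h₁ x hℓx hℓy ?_ ?_ ?_ ?_
  · intro q
    rcases hval q with ⟨h, hl⟩ | ⟨h, hl⟩ | ⟨h, hl⟩ | ⟨h, -, -, hl⟩ <;> rw [hl]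
    · exact ⟨fun _ => h, fun _ => rfl⟩
    · rw [h]; exact ⟨fun h' => absurd h' (by decide), fun h' => absurd h' h1ne⟩
    · exact ⟨fun h' => absurd h' (by decide), fun h' => absurd h' (fun h₀ => h1S (h₀ ▸ h))⟩
    · exact ⟨fun h' => absurd h' (by decide), fun h' => absurd h' h⟩
  · intro q
    rcases hval q with ⟨h, hl⟩ | ⟨h, hl⟩ | ⟨h, hl⟩ | ⟨-, h', -, hl⟩ <;> rw [hl]
    · rw [h]; exact ⟨fun h' => absurd h' (by decide), fun h' => absurd h' (Ne.symm h1ne)⟩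
    · exact ⟨fun _ => h, fun _ => rfl⟩
    · exact ⟨fun h' => absurd h' (by decide), fun h' => absurd h' (fun h₀ => hhS (h₀ ▸ h))⟩
    · exact ⟨fun h₀ => absurd h₀ (by decide), fun h₀ => absurd h₀ h'⟩
  · rw [hL1]
    omega
  · intro w
    rcases TwoGroupPieces.zmod_four_cases w with rfl | rfl | rfl | rfl
    · rw [show (0 : ZMod 4) + 3 = 3 from by decide, hC, Finset.card_sdiff_of_subset (Finset.subset_univ _),
        Finset.card_univ, hcardh]
      omega
    · rw [show (1 : ZMod 4) + 3 = 0 from by decide, hA, hcard1]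
      omega
    · rw [show (2 : ZMod 4) + 3 = 1 from by decide, hB, hcardh]
      omega
    · rw [show (3 : ZMod 4) + 3 = 2 from by decide, hD, Finset.card_sdiff_of_subset (Finset.subset_univ _),
        Finset.card_univ, hcard1]
      omega

/-- **THE UNION: (totally real Galois field of even degree `≥ 6`) · (cyclic quartic CM field) is BAD.**
`Gal(K/ℚ) ≅ H × C₄` with complex conjugation `(1, 2)` and `|H| ≥ 6` even ⟹ a SIMPLE DEGENERATE abelian variety of
dimension `2|H|` with CM by `K` (part X if some `h² ≠ 1`, the exponent-`2` construction otherwise).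
[cite: Shimura1998, §6.2 Thm. 3 and §8.2 Prop. 26] [cite: Gordon1999HodgeAVSurvey, Thm. 6.4 and §9.3] -/
theorem exists_simple_degenerate_of_real_cyclicFour_compositum'
    (e : (K ≃ₐ[ℚ] K) ≃* H × Multiplicative (ZMod 4))
    (hc : e ((IsCMField.complexConj K).restrictScalars ℚ) = (1, Multiplicative.ofAdd 2))
    (heven : Even (Fintype.card H)) (h6 : 6 ≤ Fintype.card H) :
    ∃ (Φ : CMType K) (φ₀ : K →+* ℂ) (A : AbelianVariety ℂ) (ι : 𝓞 K →+* End A)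
      (θ : K →+* Module.End ℂ (complexBetti A.X 1)),
      IsPrimitive (ℂ ≃+* ℂ) Φ.1 φ₀ ∧ ¬ IsNondegenerate Φ ∧ IsCMTypeRealisation Φ A ι θ ∧ A.IsSimple ∧
      A.dim = 2 * Fintype.card H ∧
      ∃ n p : ℕ, ∃ x : complexBetti (⨁ fun _ : Fin n => A).X (2 * p), IsRationalClass x ∧
        IsOfHodgeType (⨁ fun _ : Fin n => A).dim (⨁ fun _ : Fin n => A).X (2 * p) p p x ∧
        x ∉ divisorClassesSpan (⨁ fun _ : Fin n => A).X (⨁ fun _ : Fin n => A).dim p := by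
  by_cases hexp : ∀ h : H, h * h = 1
  · exact exists_simple_degenerate_of_real_cyclicFour_compositum_expTwo e hc heven h6 hexp
  · push Not at hexp
    obtain ⟨h₁, hh⟩ := hexp
    exact exists_simple_degenerate_of_real_cyclicFour_compositum e hc heven h6 h₁ hh

end Levels

end Summit.HodgeConjecture.CorCM.GaloisModels
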